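import Summits.BirchSwinnertonDyer.BirchSwinnertonDyer.Theorems.ClassRecordThreeExceptionalZeroRoadMainConjecture
import Literature.NumberTheory.EllipticCurves.Kato2004.Condition1252
import HarnessLib

/-!
# Route `ClassRecordThree` ∕ class X11b: the exceptional-zero road READ BACKWARDS (II) — on an X11b
# pair, Mazur's main conjecture at the pair ⟺ `BSD(E,p)` (non-split: modulo the Schneider row;
# split: modulo the Schneider row and the exceptional display), and the «exceptional-zero triangle»
# (cell `bsd-stepL`, seat `mult-p4` g1; file 2 of 2)

Cell `bsd-stepL` (D-0131 (3) middle tier, seat `bsd-stepL-mult-p4`). THEOREMS ONLY, CONDITIONAL on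
the PUBLISHED named facts in the binders (Kato `hKato`, Stein–Wuthrich Thm. 6.1 `hJs`∕`hJn` + §4.2
`hHs`∕`hHn`, Disegni 2020 Thm. 4 first bullet `hD`∕`hDf`, Gross–Zagier `hGZ`, GZK `hGZK`, modularity
`hpar`), on the per-pair certificates (Schneider for THE §4.2 datum; `ρ̄_{E,p^n}` onto) and — on
SPLIT pairs only — on the EVIDENCE-labelled conjecture `ClassClosure.RelativeExceptionalLeadingTermAt
W p`. Nothing is booked; X11b stays CONSTRUCTION-SHAPED. File 1
(`…ExceptionalZeroRoadMainConjecture.lean`) proves the converse arrows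
`mazurMainConjectureAt_of_missingLowerBoundAt_of_{split,nonsplit}`; this file packages them:

1. `mazurMainConjectureAt_of_bsdp_of_split` ∕ `…_of_nonsplit`: `BSD(E,p)` ⟹ IMC at the pair.
2. `mazurMainConjectureAt_iff_bsdp_of_nonsplit_of_schneider`: X11b pair, NON-SPLIT, odd `p`,
   `ρ̄_{E,p^n}` onto, (4.1) Schneider row: `X2.MazurMainConjectureAt W p ↔ BSDp W p` — every
   class-level input PUBLISHED (Disegni's first bullet has no restriction on `p`).
3. `mazurMainConjectureAt_iff_bsdp_of_split_of_conjecture_of_schneider`: SPLIT, granted the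
   conjecture and the split Schneider row: `X2.MazurMainConjectureAt W p ↔ BSDp W p`.
4. `mazurMainConjectureAt_iff_bsdp_of_five_le_of_surj_of_regulatorNonvanishing`: the N8-currency form
   (`p ≥ 5`, `Surj W p`, `RegulatorNonvanishingAt W p`, conjecture only if split).
5. `relativeExceptionalLeadingTermAt_of_bsdp_of_mazurMainConjectureAt`: the (ram)-FREE form of gen 0's
   tightness — `BSD(E,p)` + IMC at the pair ⟹ conjecture, height-free; and the triangle
   `relativeExceptionalLeadingTermAt_iff_mazurMainConjectureAt_of_bsdp`,
   `relativeExceptionalLeadingTermAt_iff_bsdp_of_mazurMainConjectureAt`: on a split X11b pair with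
   `ρ̄_{E,p^n}` onto and the split Schneider row, any two of {`BSD(E,p)`, conjecture, IMC at the
   pair} give the third.

## Reading (anatomy for the planner; nothing asserted about any curve)

* B10 non-split ∧ (ram) at 3 (722 classes; route road (a), crux `SchneiderAtThree`): road (a)'s
  published IMC input — Skinner 2016 Thm. A at 3, FLAG `SU14-12.3.6-mu@nonsplit@3` — is, pair by
  pair and granted the REG-MULT row + a mod-9 image certificate, EQUIVALENT to the target `BSD(E,3)`
  (item 2): it cannot be replaced by anything weaker than the target on this locus; conversely every
  non-split B10 pair closed by a flag-free road yields Skinner's conclusion at `(E,3)` flag-free.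
* B10 split ∧ (ram) at 3 (961): gen 0: conj@3 ⟸ BSD₃, conj@3 ∧ Schneider ⟹ BSD₃ (both via Skinner
  A@3); here BSD₃ ∧ conj@3 ∧ Schneider ⟹ IMC@(E,3) WITHOUT Skinner's theorem (item 1).
* N8 ¬(ram) ∧ non-split ∧ surj, `p ≥ 5`: the typed residue `X2.MazurMainConjectureAt W p` of
  `ClassClosureNotRamResidue.lean` is EXACT (⟺ `BSD(E,p)` mod the Schneider row) — the rank-one
  twin of x11a's `mazurMainConjectureAt_iff_bsdp` on N7.
* N8 split-only (55 089): the exz road (`P2.bsdp_of_surj_split_odd_of_relativeLeadingTerm`) and the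
  IMC road (`bsdp_of_mazurMainConjectureAt_of_split_of_conjecture_of_schneider`) coincide: granted
  conjecture + Schneider, IMC@pair ⟺ BSD_p.

References: [Wuthrich2014] Thm. 3, Cor. 19; [SteinWuthrich2013] Thm. 6.1, §4.2; [Disegni2020]
Thm. 4 (§3.2); [Skinner2016PacificMC] Thm. A (shape); [GrossZagier1986] I.(7.3);
[MazurTateTeitelbaum1986Invent] §II.10; [Miller2011LMS] Def. 1.1.
-/

set_option autoImplicit false

-- Theorems files of this problem live in `Summit.BirchSwinnertonDyer.BirchSwinnertonDyer.Theorems.*`.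
set_option linter.dupNamespace false

noncomputable section

open scoped Classical MatrixGroups ModularForm

open CongruenceSubgroup WeierstrassCurve Literature.NumberTheory.EllipticCurves
  Literature.NumberTheory.EllipticCurves.ModularForms
  Literature.NumberTheory.EllipticCurves.Rank1Residual
  Literature.NumberTheory.EllipticCurves.Rank1Residual.Typed
  Literature.NumberTheory.EllipticCurves.Skinner2016
  Literature.NumberTheory.EllipticCurves.SteinWuthrich2013
  Literature.NumberTheory.EllipticCurves.Wuthrich2014

namespace Summit.BirchSwinnertonDyer.BirchSwinnertonDyer.Theorems.ExceptionalZeroRoad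

open Summit.BirchSwinnertonDyer.Rank1Residual Summit.BirchSwinnertonDyer.Rank1Residual.X11b

section Class

variable (W : WeierstrassCurve ℚ) [W.IsElliptic] [W.IsGloballyMinimal] (p : ℕ) [Fact p.Prime]

/-! ### §1 `BSD(E,p)` forms of the converse -/

/-- **`BSD(E,p)` ⟹ Mazur's main conjecture at a SPLIT X11b-type pair** (odd `p`, `r_an = 1`,
`ρ̄_{E,p^n}` onto), granted the conjecture and the split Schneider certificate: Miller's `BSDp W p`
contains the lower half. [cite: Wuthrich2014, Cor. 19 proof, first case (p. 399)]
[cite: SteinWuthrich2013, Thm. 6.1, §4.2] [cite: Miller2011LMS, Def. 1.1] -/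
theorem mazurMainConjectureAt_of_bsdp_of_split
    (hKato : kato_charIdeal_dvd_multiplicative_of_surjective) (hJs : thm61_splitMultiplicative)
    (hHs : exists_isSplitMultCanonical) (hGZ : GrossZagier1986_thm_I_7_3)
    (hGZK : rank_eq_analyticRank_of_analyticRank_le_one)
    (hp2 : p ≠ 2) (hmult : W.HasMultiplicativeReductionAtPrime p)
    (hsplit : W.HasSplitMultiplicativeReductionAtPrime p) (hr : W.analyticRank = 1)
    (hρ : ∀ n : ℕ, W.HasSurjectiveModNGaloisRep (p ^ n : ℕ))
    (hC : ClassClosure.RelativeExceptionalLeadingTermAt W p)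
    (hSch : ∀ (Dq : TateParameterData W p) (Dh : PAdicHeightData W p),
      IsSplitMultCanonical Dh Dq → SchneiderConjecture Dh)
    (hbsd : BSDp W p) : X2.MazurMainConjectureAt W p := by
  haveI : Finite W.sha := (hGZK W (by omega)).2
  exact mazurMainConjectureAt_of_missingLowerBoundAt_of_split W p hKato hJs hHs hGZ hGZK hp2 hmult
    hsplit hr hρ hC hSch
    (Typed.lower_and_upper_of_missingPPartAt W p (Typed.missingPPartAt_of_bsdp W p hbsd)).1

/-- **`BSD(E,p)` ⟹ Mazur's main conjecture at a NON-SPLIT X11b-type pair** (odd `p`, `r_an = 1`,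
`ρ̄_{E,p^n}` onto), granted Disegni's non-split clause at the pair and the (4.1) Schneider
certificate. [cite: Wuthrich2014, Cor. 19 proof, first case (p. 399)]
[cite: Disegni2020, Thm. 4 first bullet (§3.2)] [cite: Miller2011LMS, Def. 1.1] -/
theorem mazurMainConjectureAt_of_bsdp_of_nonsplit
    (hKato : kato_charIdeal_dvd_multiplicative_of_surjective) (hJn : thm61_nonsplitMultiplicative)
    (hHn : exists_isMultCanonical) (hGZ : GrossZagier1986_thm_I_7_3)
    (hGZK : rank_eq_analyticRank_of_analyticRank_le_one)
    (hD : ∀ {N : ℕ} [NeZero N] {f : CuspForm (Gamma0 N) 2}, IsNewformOf W f →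
      ∀ (ϖ : ℚ), ϖ ≠ 0 → (ϖ : ℝ) * W.realPeriodRat = plusPeriod f →
      ∀ (q : ℚ_[p]), q ≠ 0 → ‖q‖ < 1 → tateJ q = (W.j : ℚ_[p]) →
      ∀ (L : PowerSeries ℚ_[p]), IsMultPAdicLFunctionOf f p (-1) L →
      ∀ (Dh : PAdicHeightData W p), IsMultCanonical Dh q →
        ∃ (s : ℚ) (u : ℤ_[p]ˣ), shaAn W = (s : ℂ) ∧
          ((ϖ : ℚ) : ℚ_[p]) * PowerSeries.coeff 1 L * padicLog p (cyclotomicGenerator p) *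
              (W.torsionOrder : ℚ_[p]) ^ 2 =
            ((u : ℤ_[p]) : ℚ_[p]) * (2 * ((s : ℚ_[p]) * padicRegulator Dh * W.tamagawaProduct)))
    (hp2 : p ≠ 2) (hmult : W.HasMultiplicativeReductionAtPrime p)
    (hns : ¬ W.HasSplitMultiplicativeReductionAtPrime p) (hr : W.analyticRank = 1)
    (hρ : ∀ n : ℕ, W.HasSurjectiveModNGaloisRep (p ^ n : ℕ))
    (hSch : ∀ (q : ℚ_[p]) (Dh : PAdicHeightData W p), q ≠ 0 → ‖q‖ < 1 → tateJ q = (W.j : ℚ_[p]) →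
      IsMultCanonical Dh q → SchneiderConjecture Dh)
    (hbsd : BSDp W p) : X2.MazurMainConjectureAt W p := by
  haveI : Finite W.sha := (hGZK W (by omega)).2
  exact mazurMainConjectureAt_of_missingLowerBoundAt_of_nonsplit W p hKato hJn hHn hGZ hGZK hD hp2
    hmult hns hr hρ hSch
    (Typed.lower_and_upper_of_missingPPartAt W p (Typed.missingPPartAt_of_bsdp W p hbsd)).1

/-! ### §2 The equivalences on an X11b pair -/

/-- **X11b pair, NON-SPLIT at the odd prime `p`, `ρ̄_{E,p^n}` onto, the pair's (4.1) Schneider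
certificate: Mazur's main conjecture at `(E,p)` ⟺ `BSD(E,p)`.** ⇒ = cc-typer-3's lever
`ClassClosure.bsdp_of_mazurMainConjectureAt_of_nonsplit_of_schneider` (SW 6.1, §4.2, Disegni
non-split at the pair, GZK, modularity); ⇐ = `mazurMainConjectureAt_of_bsdp_of_nonsplit` (+ Kato,
Gross–Zagier). EVERY class-level input is PUBLISHED (Disegni's first bullet has no restriction on
`p`); per pair: `hSch` (REG-MULT), `hρ` (image certificate; Serre at `p ≥ 5`). So on N8's
¬(ram) ∧ non-split ∧ surj atom the typed residue `X2.MazurMainConjectureAt` is EXACT, and on B10's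
722 non-split (ram) classes road (a)'s flagged input (Skinner 2016 Thm. A at 3) is equivalent to
the target pair by pair. CONDITIONAL; nothing booked.
[cite: Skinner2016PacificMC, Thm. A (§1) with §3.2–3.3 (shape only)]
[cite: Wuthrich2014, Thm. 3, Cor. 19] [cite: SteinWuthrich2013, Thm. 6.1, §4.2]
[cite: Disegni2020, Thm. 4 first bullet (§3.2)] [cite: Miller2011LMS, Def. 1.1] -/
theorem mazurMainConjectureAt_iff_bsdp_of_nonsplit_of_schneider
    (hKato : kato_charIdeal_dvd_multiplicative_of_surjective) (hJn : thm61_nonsplitMultiplicative)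
    (hHn : exists_isMultCanonical) (hGZ : GrossZagier1986_thm_I_7_3)
    (hGZK : rank_eq_analyticRank_of_analyticRank_le_one) (hpar : nonempty_modularParametrizationData)
    (hD : ∀ {N : ℕ} [NeZero N] {f : CuspForm (Gamma0 N) 2}, IsNewformOf W f →
      ∀ (ϖ : ℚ), ϖ ≠ 0 → (ϖ : ℝ) * W.realPeriodRat = plusPeriod f →
      ∀ (q : ℚ_[p]), q ≠ 0 → ‖q‖ < 1 → tateJ q = (W.j : ℚ_[p]) →
      ∀ (L : PowerSeries ℚ_[p]), IsMultPAdicLFunctionOf f p (-1) L →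
      ∀ (Dh : PAdicHeightData W p), IsMultCanonical Dh q →
        ∃ (s : ℚ) (u : ℤ_[p]ˣ), shaAn W = (s : ℂ) ∧
          ((ϖ : ℚ) : ℚ_[p]) * PowerSeries.coeff 1 L * padicLog p (cyclotomicGenerator p) *
              (W.torsionOrder : ℚ_[p]) ^ 2 =
            ((u : ℤ_[p]) : ℚ_[p]) * (2 * ((s : ℚ_[p]) * padicRegulator Dh * W.tamagawaProduct)))
    (hX : ClassX11b W p) (hns : ¬ W.HasSplitMultiplicativeReductionAtPrime p)
    (hρ : ∀ n : ℕ, W.HasSurjectiveModNGaloisRep (p ^ n : ℕ))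
    (hSch : ∀ (q : ℚ_[p]) (Dh : PAdicHeightData W p), q ≠ 0 → ‖q‖ < 1 → tateJ q = (W.j : ℚ_[p]) →
      IsMultCanonical Dh q → SchneiderConjecture Dh) :
    X2.MazurMainConjectureAt W p ↔ BSDp W p :=
  ⟨fun hMC => ClassClosure.bsdp_of_mazurMainConjectureAt_of_nonsplit_of_schneider W p hJn hHn hGZK
      hpar hD hX hns hMC hSch,
    fun h => mazurMainConjectureAt_of_bsdp_of_nonsplit W p hKato hJn hHn hGZ hGZK hD hX.2.1 hX.2.2.1
      hns hX.1 hρ hSch h⟩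

/-- **X11b pair, SPLIT at the odd prime `p`, `ρ̄_{E,p^n}` onto, the split Schneider certificate,
GRANTED the exceptional conjecture at the pair: Mazur's main conjecture at `(E,p)` ⟺ `BSD(E,p)`.**
⇒ = cc-typer-3's `ClassClosure.bsdp_of_mazurMainConjectureAt_of_split_of_conjecture_of_schneider`;
⇐ = `mazurMainConjectureAt_of_bsdp_of_split`. No (ram), no second multiplicative prime, no `p ≥ 5`
— so on N8's split-only atom the IMC road and the exz road coincide, and on B10-split at 3 the
target together with conj@3 yields Skinner's conclusion at `(E,3)` without Skinner's theorem.
CONDITIONAL on the UNPROVED conjecture; nothing booked.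
[cite: Skinner2016PacificMC, Thm. A (§1) with §3.2–3.3 (shape only)] [cite: Wuthrich2014, Thm. 3, Cor. 19]
[cite: SteinWuthrich2013, Thm. 6.1, §4.2] [cite: MazurTateTeitelbaum1986Invent, §II.10]
[cite: Miller2011LMS, Def. 1.1] -/
theorem mazurMainConjectureAt_iff_bsdp_of_split_of_conjecture_of_schneider
    (hKato : kato_charIdeal_dvd_multiplicative_of_surjective) (hJs : thm61_splitMultiplicative)
    (hHs : exists_isSplitMultCanonical) (hGZ : GrossZagier1986_thm_I_7_3)
    (hGZK : rank_eq_analyticRank_of_analyticRank_le_one) (hpar : nonempty_modularParametrizationData)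
    (hX : ClassX11b W p) (hsplit : W.HasSplitMultiplicativeReductionAtPrime p)
    (hρ : ∀ n : ℕ, W.HasSurjectiveModNGaloisRep (p ^ n : ℕ))
    (hC : ClassClosure.RelativeExceptionalLeadingTermAt W p)
    (hSch : ∀ (Dq : TateParameterData W p) (Dh : PAdicHeightData W p),
      IsSplitMultCanonical Dh Dq → SchneiderConjecture Dh) :
    X2.MazurMainConjectureAt W p ↔ BSDp W p :=
  ⟨fun hMC => ClassClosure.bsdp_of_mazurMainConjectureAt_of_split_of_conjecture_of_schneider W p hJs
      hHs hGZK hpar hX hsplit hMC hC hSch,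
    fun h => mazurMainConjectureAt_of_bsdp_of_split W p hKato hJs hHs hGZ hGZK hX.2.1 hX.2.2.1 hsplit
      hX.1 hρ hC hSch h⟩

/-- **X11b pair at `p ≥ 5` with `ρ̄_{E,p}` onto and the REG-MULT certificate `RegulatorNonvanishingAt
W p` (both signs), the conjecture demanded ONLY if `E` is split at `p`: Mazur's main conjecture at
`(E,p)` ⟺ `BSD(E,p)`.** Disegni's non-split clause enters through the named fact
`thm1_padicBSD_rankOne_multiplicative` (`hDf`); Serre turns `Surj W p` into `hρ`. The N8-currency
form of the two equivalences above. CONDITIONAL; nothing booked.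
[cite: Disegni2020, Thm. 1 (§1.2) = Thm. 4 (§3.2)] [cite: Wuthrich2014, Thm. 3, Cor. 19 (proof, p. 399)]
[cite: SteinWuthrich2013, Thm. 6.1, §4.2] [cite: Miller2011LMS, Def. 1.1] -/
theorem mazurMainConjectureAt_iff_bsdp_of_five_le_of_surj_of_regulatorNonvanishing
    (hKato : kato_charIdeal_dvd_multiplicative_of_surjective)
    (hJn : thm61_nonsplitMultiplicative) (hJs : thm61_splitMultiplicative)
    (hHn : exists_isMultCanonical) (hHs : exists_isSplitMultCanonical)
    (hDf : Disegni2020.thm1_padicBSD_rankOne_multiplicative) (hGZ : GrossZagier1986_thm_I_7_3)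
    (hGZK : rank_eq_analyticRank_of_analyticRank_le_one) (hpar : nonempty_modularParametrizationData)
    (hX : ClassX11b W p) (hp5 : 5 ≤ p) (hsurj : Surj W p)
    (hReg : ClassClosure.RegulatorNonvanishingAt W p)
    (hC : W.HasSplitMultiplicativeReductionAtPrime p → ClassClosure.RelativeExceptionalLeadingTermAt W p) :
    X2.MazurMainConjectureAt W p ↔ BSDp W p := by
  have hρ : ∀ n : ℕ, W.HasSurjectiveModNGaloisRep (p ^ n : ℕ) :=
    kato_charIdeal_dvd_multiplicative_of_surjective.surjective_pow_of_five_le W p hp5 hsurj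
  by_cases hsplit : W.HasSplitMultiplicativeReductionAtPrime p
  · exact mazurMainConjectureAt_iff_bsdp_of_split_of_conjecture_of_schneider W p hKato hJs hHs hGZ
      hGZK hpar hX hsplit hρ (hC hsplit) hReg.2
  · exact mazurMainConjectureAt_iff_bsdp_of_nonsplit_of_schneider W p hKato hJn hHn hGZ hGZK hpar
      (fun hf ϖ hϖ0 hϖ q hq0 hq1 hqj L hL Dh hDh =>
        Disegni2020.thm1_padicBSD_rankOne_multiplicative.nonsplit hDf W p hX.2.1 hX.2.2.1 hX.1 hf ϖ
          hϖ0 hϖ hsplit hq0 hq1 hqj L hL Dh hDh)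
      hX hsplit hρ hReg.1

/-! ### §3 The (ram)-free tightness and the exceptional-zero triangle on split pairs -/

/-- **(ram)-FREE tightness of the exceptional-zero road: `BSD(E,p)` + Mazur's main conjecture AT
THE PAIR ⟹ `RelativeExceptionalLeadingTermAt W p`**, at every odd `p`, HEIGHT-FREE. Gen 0's
`relativeExceptionalLeadingTermAt_of_bsdp` with Skinner 2016 Thm. A (which needs (ram)) replaced by
its conclusion at the pair (`hMC : X2.MazurMainConjectureAt W p`); the datum algebra is gen 0's
`relativeLeadingTerm_of_padicVal_eq_split` (degenerate `Reg_p`: both sides vanish). CONDITIONAL on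
SW Thm. 6.1 split, Gross–Zagier, GZK; nothing booked. [cite: SteinWuthrich2013, Thm. 6.1 (p. 20)]
[cite: GrossZagier1986, Thm. I.(7.3) 2)] [cite: Skinner2016PacificMC, Thm. A with §3.3 (shape only)]
[cite: Miller2011LMS, Def. 1.1] [cite: MazurTateTeitelbaum1986Invent, §II.10 (exceptional case)] -/
theorem relativeExceptionalLeadingTermAt_of_bsdp_of_mazurMainConjectureAt
    (hJs : thm61_splitMultiplicative) (hGZ : GrossZagier1986_thm_I_7_3)
    (hGZK : rank_eq_analyticRank_of_analyticRank_le_one)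
    (hMC : X2.MazurMainConjectureAt W p) (h : BSDp W p) :
    ClassClosure.RelativeExceptionalLeadingTermAt W p := by
  intro N _ f hp2 hsplit hr hf ϖ hϖ0 hϖ Dq L hL Dh hDh
  obtain ⟨κ, hκ, γ, hγ, hγ'⟩ := exists_isCyclotomic_isTopGenerator_isCyclotomicVariable_holds p
  obtain ⟨D⟩ := W.nonempty_selmerDualData_holds κ γ hγ
  -- Mazur's statement for this datum (split clause): torsion, generator, unit cofactor
  obtain ⟨hXt, g, hchar, hsp, -⟩ := hMC κ γ hκ hγ hγ' f hf D ϖ hϖ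
  obtain ⟨w, hw⟩ := hsp hsplit L hL
  -- `#Ш_an = s ∈ ℚ^×` (GZ) with Miller's valuation clause (BSD(E,p))
  obtain ⟨-, -, s, hs, hval⟩ := h
  obtain ⟨s', hs'0, hs'⟩ := exists_rat_ne_zero_shaAn_eq_of_analyticRank_eq_one hGZ hGZK W hr
  have hss' : s = s' := by
    have : ((s : ℚ) : ℂ) = ((s' : ℚ) : ℂ) := hs.symm.trans hs'
    exact_mod_cast this
  have hs0 : s ≠ 0 := hss' ▸ hs'0
  obtain ⟨u', hu'⟩ := relativeLeadingTerm_of_padicVal_eq_split hJs hGZK hp2 hr Dq hκ hγ hγ' D hXt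
    hchar w hw Dh hDh hs0 hval
  exact ⟨s, u', hs, hu'⟩

/-- **The exceptional-zero triangle, vertex `BSD(E,p)`: on a SPLIT X11b pair with `ρ̄_{E,p^n}` onto
and the split Schneider certificate, GRANTED `BSD(E,p)`, the conjecture at the pair ⟺ Mazur's main
conjecture at the pair** (⇒ `mazurMainConjectureAt_of_bsdp_of_split`; ⇐
`relativeExceptionalLeadingTermAt_of_bsdp_of_mazurMainConjectureAt`, height-free). With
`mazurMainConjectureAt_iff_bsdp_of_split_of_conjecture_of_schneider` (vertex: conjecture) and the
lever ∕ tightness pair (vertex: IMC — `bsdp_of_mazurMainConjectureAt_of_split_of_conjecture_of_schneider`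
and the previous theorem): any two of {`BSD(E,p)`, conjecture, IMC at the pair} give the third.
So every B10-split class closed by the route (which proves conj@3 on (ram), gen 0) also yields the
IMC at `(E,3)` from Kato's divisibility alone wherever a Schneider row and a mod-9 image certificate
exist. CONDITIONAL; nothing booked. [cite: Wuthrich2014, Thm. 3, Cor. 19]
[cite: SteinWuthrich2013, Thm. 6.1, §4.2] [cite: GrossZagier1986, Thm. I.(7.3) 2)]
[cite: MazurTateTeitelbaum1986Invent, §II.10] [cite: Miller2011LMS, Def. 1.1] -/
theorem relativeExceptionalLeadingTermAt_iff_mazurMainConjectureAt_of_bsdp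
    (hKato : kato_charIdeal_dvd_multiplicative_of_surjective) (hJs : thm61_splitMultiplicative)
    (hHs : exists_isSplitMultCanonical) (hGZ : GrossZagier1986_thm_I_7_3)
    (hGZK : rank_eq_analyticRank_of_analyticRank_le_one)
    (hX : ClassX11b W p) (hsplit : W.HasSplitMultiplicativeReductionAtPrime p)
    (hρ : ∀ n : ℕ, W.HasSurjectiveModNGaloisRep (p ^ n : ℕ))
    (hSch : ∀ (Dq : TateParameterData W p) (Dh : PAdicHeightData W p),
      IsSplitMultCanonical Dh Dq → SchneiderConjecture Dh)
    (h : BSDp W p) :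
    ClassClosure.RelativeExceptionalLeadingTermAt W p ↔ X2.MazurMainConjectureAt W p :=
  ⟨fun hC => mazurMainConjectureAt_of_bsdp_of_split W p hKato hJs hHs hGZ hGZK hX.2.1 hX.2.2.1 hsplit
      hX.1 hρ hC hSch h,
    fun hMC => relativeExceptionalLeadingTermAt_of_bsdp_of_mazurMainConjectureAt W p hJs hGZ hGZK hMC h⟩

/-- **The triangle, vertex IMC: on a SPLIT X11b pair with the split Schneider certificate, GRANTED
Mazur's main conjecture at the pair, the conjecture ⟺ `BSD(E,p)`** (⇒ cc-typer-3's lever with the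
conjecture; ⇐ the (ram)-free tightness). Gen 0's `…_three_iff_bsdp_of_schneiderSplit` is the instance
in which the IMC vertex is supplied by Skinner 2016 Thm. A on (ram). CONDITIONAL; nothing booked.
[cite: SteinWuthrich2013, Thm. 6.1, §4.2] [cite: GrossZagier1986, Thm. I.(7.3) 2)]
[cite: Skinner2016PacificMC, Thm. A (shape only)] [cite: Miller2011LMS, Def. 1.1] -/
theorem relativeExceptionalLeadingTermAt_iff_bsdp_of_mazurMainConjectureAt
    (hJs : thm61_splitMultiplicative) (hHs : exists_isSplitMultCanonical)
    (hGZ : GrossZagier1986_thm_I_7_3) (hGZK : rank_eq_analyticRank_of_analyticRank_le_one)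
    (hpar : nonempty_modularParametrizationData)
    (hX : ClassX11b W p) (hsplit : W.HasSplitMultiplicativeReductionAtPrime p)
    (hSch : ∀ (Dq : TateParameterData W p) (Dh : PAdicHeightData W p),
      IsSplitMultCanonical Dh Dq → SchneiderConjecture Dh)
    (hMC : X2.MazurMainConjectureAt W p) :
    ClassClosure.RelativeExceptionalLeadingTermAt W p ↔ BSDp W p :=
  ⟨fun hC => ClassClosure.bsdp_of_mazurMainConjectureAt_of_split_of_conjecture_of_schneider W p hJs
      hHs hGZK hpar hX hsplit hMC hC hSch,
    fun h => relativeExceptionalLeadingTermAt_of_bsdp_of_mazurMainConjectureAt W p hJs hGZ hGZK hMC h⟩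

end Class

/-! ### §4 (appended) Certificate currency at `p = 3`: one REGMULT row + one mod-`9` image certificate -/

section Three

variable (W : WeierstrassCurve ℚ) [W.IsElliptic] [W.IsGloballyMinimal]

/-- **B10, NON-SPLIT at `3` (the 722 TRUE-OPEN non-split (ram) classes and every other X11b@3
non-split pair): granted ONE REGMULT row `RegMult.CertNonsplit W 3 P m` (the (4.1) height of `m·P` is
non-zero; 723∕723 rows CERT in `regmult_prod_X11b3_nonsplit.tsv`) and ONE mod-`9` image certificate
(`ρ̄_{E,9}` onto ⟹ `ρ̄_{E,3^n}` onto for all `n`, `forall_hasSurjectiveModNGaloisRep_three_pow_of_nine`),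
Mazur's main conjecture at `(E,3)` — the CONCLUSION of Skinner 2016 Thm. A at `3`, which road (a) of
the route cites with FLAG `SU14-12.3.6-mu@nonsplit@3` — is EQUIVALENT to `BSD(E,3)`.** Every
class-level input is a PUBLISHED named fact (Kato `hKato`, SW Thm. 6.1 non-split `hJn` + §4.2 `hHn`,
Disegni 2020 Thm. 1 non-split clause `hDf`, Gross–Zagier `hGZ`, GZK `hGZK`, modularity `hpar`); no
(ram) is used. CONDITIONAL; instrument rows are EVIDENCE, never facts; nothing booked.
[cite: Skinner2016PacificMC, Thm. A (§1) (shape only; its conclusion is the left-hand side)]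
[cite: Disegni2020, Thm. 1 (§1.2) = Thm. 4 first bullet (§3.2)] [cite: Wuthrich2014, Thm. 3, Cor. 19]
[cite: SteinWuthrich2013, Thm. 6.1, §4.2 (p. 15)] [cite: SerreAbelianLadic1968, Ch. IV §3.4, Lemma 3]
[cite: Miller2011LMS, Def. 1.1] -/
theorem Three.mazurMainConjectureAt_iff_bsdp_of_nonsplit_of_cert_of_nine [Fact (Nat.Prime 3)]
    (hKato : kato_charIdeal_dvd_multiplicative_of_surjective) (hJn : thm61_nonsplitMultiplicative)
    (hHn : exists_isMultCanonical) (hDf : Disegni2020.thm1_padicBSD_rankOne_multiplicative)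
    (hGZ : GrossZagier1986_thm_I_7_3) (hGZK : rank_eq_analyticRank_of_analyticRank_le_one)
    (hpar : nonempty_modularParametrizationData)
    (hX : ClassX11b W 3) (hns : ¬ W.HasSplitMultiplicativeReductionAtPrime 3)
    (h9 : W.HasSurjectiveModNGaloisRep 9) {P : W.toAffine.Point} {m : ℕ}
    (hc : RegMult.CertNonsplit W 3 P m) :
    X2.MazurMainConjectureAt W 3 ↔ BSDp W 3 :=
  mazurMainConjectureAt_iff_bsdp_of_nonsplit_of_schneider W 3 hKato hJn hHn hGZ hGZK hpar
    (fun hf ϖ hϖ0 hϖ _ hq0 hq1 hqj L hL Dh hDh =>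
      Disegni2020.thm1_padicBSD_rankOne_multiplicative.nonsplit hDf W 3 hX.2.1 hX.2.2.1 hX.1 hf ϖ hϖ0
        hϖ hns hq0 hq1 hqj L hL Dh hDh)
    hX hns (forall_hasSurjectiveModNGaloisRep_three_pow_of_nine W h9)
    (RegMult.schneiderHalf_nonsplit_of_cert (mordellWeilRank_eq_one_of_analyticRank hGZK hX.1) hc)

/-- **B10, SPLIT at `3` (the 961 TRUE-OPEN split (ram) classes; 960∕961 REGMULT rows CERT in
`regmult_prod_X11b3_split.tsv`): granted ONE split row `RegMult.CertSplit W 3 P m`, ONE mod-`9` image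
certificate AND the exceptional conjecture at `3` (`RelativeExceptionalLeadingTermAt W 3`, beyond print;
census EVIDENCE on `N < 10³` rows only — all 961 classes have `N ≥ 2·10⁴`), Mazur's main conjecture at
`(E,3)` ⟺ `BSD(E,3)`.** No (ram), no Skinner theorem. CONDITIONAL on the UNPROVED conjecture;
nothing booked. [cite: Skinner2016PacificMC, Thm. A (shape only)] [cite: Wuthrich2014, Thm. 3, Cor. 19]
[cite: SteinWuthrich2013, Thm. 6.1, §4.2 (p. 16)] [cite: MazurTateTeitelbaum1986Invent, §II.10]
[cite: SerreAbelianLadic1968, Ch. IV §3.4, Lemma 3] [cite: Miller2011LMS, Def. 1.1] -/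
theorem Three.mazurMainConjectureAt_iff_bsdp_of_split_of_cert_of_nine_of_conjecture
    [Fact (Nat.Prime 3)]
    (hKato : kato_charIdeal_dvd_multiplicative_of_surjective) (hJs : thm61_splitMultiplicative)
    (hHs : exists_isSplitMultCanonical) (hGZ : GrossZagier1986_thm_I_7_3)
    (hGZK : rank_eq_analyticRank_of_analyticRank_le_one) (hpar : nonempty_modularParametrizationData)
    (hX : ClassX11b W 3) (hsplit : W.HasSplitMultiplicativeReductionAtPrime 3)
    (h9 : W.HasSurjectiveModNGaloisRep 9) {P : W.toAffine.Point} {m : ℕ}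
    (hc : RegMult.CertSplit W 3 P m) (hC : ClassClosure.RelativeExceptionalLeadingTermAt W 3) :
    X2.MazurMainConjectureAt W 3 ↔ BSDp W 3 :=
  mazurMainConjectureAt_iff_bsdp_of_split_of_conjecture_of_schneider W 3 hKato hJs hHs hGZ hGZK hpar
    hX hsplit (forall_hasSurjectiveModNGaloisRep_three_pow_of_nine W h9) hC
    (RegMult.schneiderHalf_split_of_cert (mordellWeilRank_eq_one_of_analyticRank hGZK hX.1) hc)

/-- **What the route's rung leaf gives on the non-split locus, flag-free.** The leaf
`X11b.MultiplicativeRankOneAtThree` (what `ClassRecordThree` closes) implies, for every X11b pair at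
`3` NON-SPLIT at `3` carrying one REGMULT row and one mod-`9` image certificate, Mazur's main
conjecture at `(E,3)` — Skinner 2016 Thm. A's conclusion there — from Kato's divisibility, SW Thm.
6.1, Disegni's non-split clause, Gross–Zagier, GZK and modularity, WITHOUT Skinner–Urban: a by-product
of closing B10 by the route's height-free roads, in the same way as gen 0's
`relativeExceptionalLeadingTermAt_three_of_multiplicativeRankOneAtThree` on the split locus.
CONDITIONAL on the leaf taken as a hypothesis; nothing booked.
[cite: Skinner2016PacificMC, Thm. A (shape only)] [cite: Disegni2020, Thm. 4 first bullet (§3.2)]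
[cite: Wuthrich2014, Thm. 3, Cor. 19] [cite: Miller2011LMS, Def. 1.1] -/
theorem Three.mazurMainConjectureAt_of_multiplicativeRankOneAtThree_of_nonsplit_of_cert_of_nine
    [Fact (Nat.Prime 3)]
    (hKato : kato_charIdeal_dvd_multiplicative_of_surjective) (hJn : thm61_nonsplitMultiplicative)
    (hHn : exists_isMultCanonical) (hDf : Disegni2020.thm1_padicBSD_rankOne_multiplicative)
    (hGZ : GrossZagier1986_thm_I_7_3) (hGZK : rank_eq_analyticRank_of_analyticRank_le_one)
    (hpar : nonempty_modularParametrizationData) (hleaf : X11b.MultiplicativeRankOneAtThree)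
    (hX : ClassX11b W 3) (hns : ¬ W.HasSplitMultiplicativeReductionAtPrime 3)
    (h9 : W.HasSurjectiveModNGaloisRep 9) {P : W.toAffine.Point} {m : ℕ}
    (hc : RegMult.CertNonsplit W 3 P m) : X2.MazurMainConjectureAt W 3 :=
  (Three.mazurMainConjectureAt_iff_bsdp_of_nonsplit_of_cert_of_nine W hKato hJn hHn hDf hGZ hGZK hpar
    hX hns h9 hc).mpr (hleaf W hX)

end Three

end Summit.BirchSwinnertonDyer.BirchSwinnertonDyer.Theorems.ExceptionalZeroRoad

end
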